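import Summits.AtomisticToContinuum.FouriersLaw.Theses.ContactEchoEpochs

/-!
# `ContactEchoEpochs.Assembly` — PROVED

Route `AtomisticToContinuum/FouriersLaw/ContactEchoEpochs`, assembly item
`stmt-AtomisticToContinuum-13585` (`Assembly`):

  `NessUnique → PinnedSteadyStateExists → ContactKubo → DarkTime →
   EquilibriumFluctuationWindow → PolynomialGapTail → EchoLimitOfWindows → FouriersLaw`.

The route file carries the planner-authored, sorry-free D-0027 §2.1 deciding theorem
`Summit.AtomisticToContinuum.FouriersLaw.Theses.ContactEchoEpochs.closes`, whose type is literally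
the body of `Assembly` (route-repair 2026-08-15: `PinnedSteadyStateExists` inserted after
`NessUnique` when the `LangevinChainNESSHolds` import was dropped); this file records the
item-closing theorem whose type is the route decl `Assembly` by name.  For the mathematics
(clause (i) of `FouriersLawFor` from `PinnedSteadyStateExists` + `NessUnique`; clause (ii) from
the contact-echo limit `EchoLimit := EchoLimitOfWindows ContactKubo NessUnique DarkTime
EquilibriumFluctuationWindow PolynomialGapTail`, with `D 0 = D 1 = 0` (no bonds) and
`D (n+2) = (n+1) T⁻² ∫₀^∞ c_(n+2)` whose `δ → 0` response limit is `ContactKubo`) see the proof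
of `closes` in the route file.  No named-fact hypotheses: the theorem is unconditional (its
axioms are those of `closes`: `propext`, `Classical.choice`, `Quot.sound`).
-/

namespace Summit.AtomisticToContinuum.FouriersLaw.Theorems

/-- Settles `stmt-AtomisticToContinuum-13585` (assembly of route `ContactEchoEpochs`): weak
steady-state uniqueness `NessUnique`, existence `PinnedSteadyStateExists`, the contact form of the
finite-volume Kubo formula `ContactKubo`, the three time windows `DarkTime` (W1),
`EquilibriumFluctuationWindow` (W2), `PolynomialGapTail` (W3) and the glue `EchoLimitOfWindows`
imply the sub-problem statement `FouriersLaw`.  Proof: the route's deciding theorem `closes`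
(after unfolding `Assembly`). [folklore] -/
theorem contactEchoEpochs_assembly_proof :
    Summit.AtomisticToContinuum.FouriersLaw.Theses.ContactEchoEpochs.Assembly := by
  unfold Summit.AtomisticToContinuum.FouriersLaw.Theses.ContactEchoEpochs.Assembly
  exact Summit.AtomisticToContinuum.FouriersLaw.Theses.ContactEchoEpochs.closes

end Summit.AtomisticToContinuum.FouriersLaw.Theorems
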